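import Mathlib
import Summits.QuantumFields.BalabanUV.T4Continuum.Support.SliceFlatGaugeProjection

/-!
# T⁴ programme, node NE3 — BRIDGE-126, part 1b: the (1.44)-form gauge-fixing projection with CONCRETE matrix inverses
# on pv15's fine torus, and the gradient sandwich `reM (∂·PcT·∂ᴴ) = Re ∂ · P_G · (Re ∂)ᵀ`

Fourteenth generation of the NE3 prover lineage P1 of the cell `pub-balaban`, file 2b (continues `SliceFlatGaugeProjection`,
whose `PcT_apply_eq_P144` says: pv15's (1.70)-form `Re PcT` agrees on `1^⊥` with reader A's (1.44)-form `P144 Q′ Q′ᵀ g c₂`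
for EVERY `GreenData`).  THIS FILE supplies CONCRETE `GreenData` as real matrices and the deliverable of part 1:
 * `Km a c := Re Δ_c + a·(Re Q′)ᵀ·Re Q′` is positive definite (**`Km_posDef`**: `Δ ≥ 0`, `> 0` on `1^⊥` — p. 22 — and
   `Q′u = 0 ⇒ u ⊥ 1`), `Gm := Km⁻¹` ([B5] p. 25 «its inverse is a bounded operator G′_k»), `QGGQm := Re Q′·Gm·Gm·(Re Q′)ᵀ`
   positive definite (**`QGGQm_posDef`**: «‖G′_kQ′_k*ω‖² = 0, then Q′_k*ω = 0, hence ω = 0», p. 25), `Cm := QGGQm⁻¹`,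
   **`greenData_matrix`** (they form reader A's `GreenData` on the typed torus);
 * **`PGm := Gm·(Re Q′)ᵀ·Cm·Re Q′·Gm`** and **`reM_PcT_mulVec_of_orth`**: `Re PcT u = PGm u` for every real `u` with `Σu = 0`;
 * `sum_reM_GradOp_row` (every column of `∂ᴴ` sums to zero on the torus), `reM_PcT_mul_GradOp_transpose`, and the
   deliverable **`reM_GradOp_PcT_GradOp`**: `reM (∂_c · PcT · ∂_cᴴ) = reM ∂_c · PGm a c · (reM ∂_c)ᵀ` for every real `c ≠ 0`
   and `a > 0` — pv15's `∂P∂*` of [B5] (1.69)–(1.70) (inside `B5DeltaA169.DeltaA`, hence inside NE3's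
   `SliceFlatMassTerm.gaugeDev`) IS the gradient sandwich of the (1.44)-form projection with concrete inverses.
WHAT THIS BUYS (honest): the form in which b04's torus Green kernel `K_T` (`B4TorusGreen244.torusGreen244` ∕
`B4TorusPositivity.torusGreen244_unique`) and b05's `qggqRe`∕`kerRe`∕`KRe`∕`Dmat` can be matched entry by entry across the
carrier bijection `Tor (fine n N) ≃ Idx (n·N)` (part 2 of BRIDGE-126, NOT here), after which b05's n- and volume-uniform
`B5DPD126Uniform.matrixP_decay_uniform` is the (3.49) gauge half at `U = 1`.  Nothing here is an estimate; NE3 is NOT proved.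

Honest framing: finite-T⁴ ultraviolet bookkeeping about MINIMISERS (rung (B)+1 of the cell's ladder); no conditional of the
cell (`BetaPertH`, (B), (B^μ)) is used or hidden; nothing bears on infinite volume, a mass gap, or the Clay problem.
ABSOLUTE RULE of the cell kept: inputs are kernel-proved tree modules only; `[B5]` page pointers locate DEFINITIONS only.  No
`sorry`, no axioms beyond Mathlib's.  PLACEMENT (human rule 2026-08-19): cell work under `Summits/QuantumFields/BalabanUV/`;
imports `Support.SliceFlatGaugeProjection` only; moves nothing.  Records: `t4/T4-EST-U1b-OSC.md` v1.29 (RESULT 37),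
`t4/T4-EST-NE3-P1.md` v2.28, GAPS G-ne3p1-43 of the cell `pub-balaban`.
-/

noncomputable section

open scoped InnerProductSpace Matrix ComplexConjugate
open Finset Matrix

namespace Summit.QuantumFields.BalabanUV.T4Continuum.SliceFlatGaugeGreen

open Literature.MathematicalPhysics.QuantumFieldTheory.Balaban1983to89
open Literature.MathematicalPhysics.QuantumFieldTheory.Balaban1983to89.B5Prop11Plancherel (Tor fine unitVec)
open Literature.MathematicalPhysics.QuantumFieldTheory.Balaban1983to89.B5Action121 (LapS GradOp sdiff shiftS)
open Literature.MathematicalPhysics.QuantumFieldTheory.Balaban1983to89.B5Block118 (QsOp)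
open Literature.MathematicalPhysics.QuantumFieldTheory.Balaban1983to89.B5Value126 (PcT PcT_mulVec)
open Literature.MathematicalPhysics.QuantumFieldTheory.Balaban1983to89.B5RealFields
  (reM cplx IsReal cplx_apply cplx_eq_zero_iff reM_conjTranspose reM_transpose_of_isHermitian isReal_LapS isReal_QsOp
    isReal_PcT isReal_GradOp)
open Literature.MathematicalPhysics.QuantumFieldTheory.Balaban1983to89.B5GaussSectC (L2T DeltaT ofLp_DeltaT)
open Literature.MathematicalPhysics.QuantumFieldTheory.Balaban1983to89.B5Projector144
open Literature.MathematicalPhysics.QuantumFieldTheory.Balaban1983to89.B5Projector144Torus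
open Summit.QuantumFields.BalabanUV.T4Continuum.SliceFlatGaugeProjection

variable {d : ℕ} (n : ℕ) [NeZero n] (M : Fin d → ℕ) [hM : ∀ μ, NeZero (M μ)]

/-! ## §1  The concrete (1.44) data as real matrices -/

/-- `K_a := Re Δ + a·(Re Q′)ᵀ·Re Q′` — the real matrix of `Δ′_a = Δ + aQ′*Q′` ([B5] p. 25) in the unweighted
(transpose) adjoint convention of `B5Projector144Torus`. [model] -/
def Km (a c : ℝ) : Matrix (Tor (fine n M)) (Tor (fine n M)) ℝ :=
  reM (LapS (fine n M) (c : ℂ)) + a • ((reM (QsOp n M))ᵀ * reM (QsOp n M))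

/-- `Δ′_a` acts as `Δ + a·Q′ᵀQ′`. [folklore] -/
theorem Km_mulVec (a c : ℝ) (u : Tor (fine n M) → ℝ) :
    Km n M a c *ᵥ u = reM (LapS (fine n M) (c : ℂ)) *ᵥ u + a • ((reM (QsOp n M))ᵀ *ᵥ (reM (QsOp n M) *ᵥ u)) := by
  rw [Km, Matrix.add_mulVec, Matrix.smul_mulVec, Matrix.mulVec_mulVec]

/-- `K_a` is symmetric. [folklore] -/
theorem Km_isHermitian (a c : ℝ) : (Km n M a c).IsHermitian := by
  have h1 := isHermitian_reM_LapS n M c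
  have h2 : ((reM (QsOp n M))ᵀ * reM (QsOp n M)).IsHermitian := by
    simpa only [Matrix.conjTranspose_eq_transpose_of_trivial] using
      Matrix.isHermitian_conjTranspose_mul_self (reM (QsOp n M))
  unfold Km
  exact h1.add (h2.smul (IsSelfAdjoint.all a))

/-- `Σ_y (Q′f)(y) = n^{−d}·Σ_x f(x)` on real fields: `Q′u = 0 ⇒ u ⊥ 1`. [folklore] -/
theorem sum_eq_zero_of_QsOp_mulVec_eq_zero (u : Tor (fine n M) → ℝ) (hu : reM (QsOp n M) *ᵥ u = 0) :
    ∑ x, u x = 0 := by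
  have hn : (1 / (n : ℂ) ^ d) ≠ 0 := by
    have : (n : ℂ) ≠ 0 := by exact_mod_cast NeZero.ne n
    exact one_div_ne_zero (pow_ne_zero _ this)
  have h := B5Blocks16.sum_QsOp n M (cplx u)
  rw [← (isReal_QsOp n M).cplx_mulVec, hu] at h
  have h0 : (0 : ℂ) = 1 / (n : ℂ) ^ d * ∑ x, cplx u x := by simpa using h
  rw [sum_cplx] at h0
  have h1 : ((∑ x, u x : ℝ) : ℂ) = 0 := by
    rcases mul_eq_zero.mp h0.symm with h2 | h2
    · exact absurd h2 hn
    · exact h2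
  exact_mod_cast h1

/-- **`K_a = Δ + aQ′ᵀQ′` IS POSITIVE DEFINITE** (`c ≠ 0`, `a > 0`): `⟨u, Δu⟩ ≥ 0` always and `> 0` on `1^⊥ ∖ {0}`
(p. 22), `a‖Q′u‖² > 0` unless `Q′u = 0`, and `Q′u = 0 ⇒ u ⊥ 1` — [B5] p. 25 «its inverse is a bounded operator G′_k»,
for the typed torus objects. [folklore] -/
theorem Km_posDef {c : ℝ} (hc : c ≠ 0) {a : ℝ} (ha : 0 < a) : (Km n M a c).PosDef :=
  PosDef.of_dotProduct_mulVec_pos (Km_isHermitian n M a c) fun u hu => by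
    rw [star_trivial, Km_mulVec, dotProduct_add, dotProduct_smul, dot_transpose_mulVec, smul_eq_mul]
    have h1 : 0 ≤ u ⬝ᵥ (reM (LapS (fine n M) (c : ℂ)) *ᵥ u) := by
      have := DeltaT_nonneg n M c (WithLp.toLp 2 u)
      rwa [inner_DeltaT, WithLp.ofLp_toLp, dotProduct_comm] at this
    by_cases hQ : reM (QsOp n M) *ᵥ u = 0
    · have hsum := sum_eq_zero_of_QsOp_mulVec_eq_zero n M u hQ
      have hne : (WithLp.toLp 2 u : L2T n M) ≠ 0 := by
        intro h0
        apply hu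
        have := congrArg WithLp.ofLp h0
        rwa [WithLp.ofLp_toLp, WithLp.ofLp_zero] at this
      have hpos := DeltaT_posK n M hc (WithLp.toLp 2 u) (by rw [inner_oneT, WithLp.ofLp_toLp]; exact hsum) hne
      rw [inner_DeltaT, WithLp.ofLp_toLp, dotProduct_comm] at hpos
      rw [hQ, dotProduct_zero, mul_zero, add_zero]
      exact hpos
    · have hpos : 0 < (reM (QsOp n M) *ᵥ u) ⬝ᵥ (reM (QsOp n M) *ᵥ u) := by
        have := (dotProduct_star_self_pos_iff).mpr hQ
        rwa [star_trivial] at this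
      have : 0 < a * ((reM (QsOp n M) *ᵥ u) ⬝ᵥ (reM (QsOp n M) *ᵥ u)) := mul_pos ha hpos
      linarith

/-- `G′ := K_a⁻¹` — the CONCRETE (1.44) Green operator on pv15's carrier (real matrix inverse). [model] -/
def Gm (a c : ℝ) : Matrix (Tor (fine n M)) (Tor (fine n M)) ℝ := (Km n M a c)⁻¹

/-- `K_a · G′ = 1`. [folklore] -/
theorem Km_mul_Gm {c : ℝ} (hc : c ≠ 0) {a : ℝ} (ha : 0 < a) : Km n M a c * Gm n M a c = 1 :=
  mul_nonsing_inv _ ((isUnit_iff_isUnit_det _).mp (Km_posDef n M hc ha).isUnit)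

/-- `G′ · K_a = 1`. [folklore] -/
theorem Gm_mul_Km {c : ℝ} (hc : c ≠ 0) {a : ℝ} (ha : 0 < a) : Gm n M a c * Km n M a c = 1 :=
  nonsing_inv_mul _ ((isUnit_iff_isUnit_det _).mp (Km_posDef n M hc ha).isUnit)

/-- `K_a` is symmetric as a real matrix. [folklore] -/
theorem Km_transpose (a c : ℝ) : (Km n M a c)ᵀ = Km n M a c := by
  have h := Km_isHermitian n M a c
  change (Km n M a c)ᴴ = Km n M a c at h
  rwa [conjTranspose_eq_transpose_of_trivial] at h

/-- `G′` is symmetric. [folklore] -/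
theorem Gm_transpose (a c : ℝ) : (Gm n M a c)ᵀ = Gm n M a c := by
  rw [Gm, transpose_nonsing_inv, Km_transpose]

/-- `Q′G′²Q′ᵀ` — the CONCRETE matrix of [B5] (1.44)'s `Q′_kG′_k²Q′_k*` (transpose-adjoint convention). [model] -/
def QGGQm (a c : ℝ) : Matrix (Tor M) (Tor M) ℝ :=
  reM (QsOp n M) * Gm n M a c * Gm n M a c * (reM (QsOp n M))ᵀ

/-- `Q′G′²Q′ᵀ = (G′Q′ᵀ)ᵀ · (G′Q′ᵀ)` (`G′` symmetric) — the printed «⟨ω, Q′G′²Q′*ω⟩ = ‖G′Q′*ω‖²», p. 25. [folklore] -/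
theorem QGGQm_eq_transpose_mul (a c : ℝ) :
    QGGQm n M a c = (Gm n M a c * (reM (QsOp n M))ᵀ)ᵀ * (Gm n M a c * (reM (QsOp n M))ᵀ) := by
  rw [QGGQm, transpose_mul, transpose_transpose, Gm_transpose]
  simp only [Matrix.mul_assoc]

/-- `Q′ᵀ` is injective on real fields (b05-g13's `QsT_injective`, matrix form). [folklore] -/
theorem QsOp_transpose_mulVec_injective (φ : Tor M → ℝ) (h : (reM (QsOp n M))ᵀ *ᵥ φ = 0) : φ = 0 := by
  have h1 : QsT n M (WithLp.toLp 2 φ) = 0 := by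
    apply WithLp.ofLp_injective 2
    rw [ofLp_QsT, WithLp.ofLp_toLp, h, WithLp.ofLp_zero]
  have h2 := QsT_injective n M (a₁ := WithLp.toLp 2 φ) (a₂ := 0) (by rw [h1, map_zero])
  have := congrArg WithLp.ofLp h2
  rwa [WithLp.ofLp_toLp, WithLp.ofLp_zero] at this

/-- **`Q′G′²Q′ᵀ` IS POSITIVE DEFINITE** (`c ≠ 0`, `a > 0`): «if … ‖G′_kQ′_k*ω‖² = 0, then Q′_k*ω = 0, hence ω = 0»,
p. 25, for the concrete matrices. [folklore] -/
theorem QGGQm_posDef {c : ℝ} (hc : c ≠ 0) {a : ℝ} (ha : 0 < a) : (QGGQm n M a c).PosDef := by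
  have hH : (QGGQm n M a c).IsHermitian := by
    rw [QGGQm_eq_transpose_mul]
    simpa only [Matrix.conjTranspose_eq_transpose_of_trivial] using
      Matrix.isHermitian_conjTranspose_mul_self (Gm n M a c * (reM (QsOp n M))ᵀ)
  refine PosDef.of_dotProduct_mulVec_pos hH fun φ hφ => ?_
  rw [star_trivial, QGGQm_eq_transpose_mul, ← Matrix.mulVec_mulVec, dot_transpose_mulVec]
  have hne : (Gm n M a c * (reM (QsOp n M))ᵀ) *ᵥ φ ≠ 0 := by
    intro h0
    apply hφ
    apply QsOp_transpose_mulVec_injective n M φ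
    have h1 : Km n M a c *ᵥ ((Gm n M a c * (reM (QsOp n M))ᵀ) *ᵥ φ) = 0 := by rw [h0, Matrix.mulVec_zero]
    rwa [Matrix.mulVec_mulVec, ← Matrix.mul_assoc, Km_mul_Gm n M hc ha, Matrix.one_mul] at h1
  have := (dotProduct_star_self_pos_iff).mpr hne
  rwa [star_trivial] at this

/-- `(Q′G′²Q′ᵀ)⁻¹` — the CONCRETE matrix of [B5] (1.44)'s `(Q′_kG′_k²Q′_k*)⁻¹`. [model] -/
def Cm (a c : ℝ) : Matrix (Tor M) (Tor M) ℝ := (QGGQm n M a c)⁻¹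

/-- `(Q′G′²Q′ᵀ) · (Q′G′²Q′ᵀ)⁻¹ = 1`. [folklore] -/
theorem QGGQm_mul_Cm {c : ℝ} (hc : c ≠ 0) {a : ℝ} (ha : 0 < a) : QGGQm n M a c * Cm n M a c = 1 :=
  mul_nonsing_inv _ ((isUnit_iff_isUnit_det _).mp (QGGQm_posDef n M hc ha).isUnit)

/-- `(Q′G′²Q′ᵀ)⁻¹ · (Q′G′²Q′ᵀ) = 1`. [folklore] -/
theorem Cm_mul_QGGQm {c : ℝ} (hc : c ≠ 0) {a : ℝ} (ha : 0 < a) : Cm n M a c * QGGQm n M a c = 1 :=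
  nonsing_inv_mul _ ((isUnit_iff_isUnit_det _).mp (QGGQm_posDef n M hc ha).isUnit)

/-- `Q′G′²Q′ᵀ` acts as the composition. [folklore] -/
theorem QGGQm_mulVec (a c : ℝ) (φ : Tor M → ℝ) :
    QGGQm n M a c *ᵥ φ = reM (QsOp n M) *ᵥ (Gm n M a c *ᵥ (Gm n M a c *ᵥ ((reM (QsOp n M))ᵀ *ᵥ φ))) := by
  rw [QGGQm, ← Matrix.mulVec_mulVec, ← Matrix.mulVec_mulVec, ← Matrix.mulVec_mulVec]

/-- **The concrete matrices form reader A's `GreenData`** on the typed torus (`c ≠ 0`, `a > 0`). [folklore] -/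
theorem greenData_matrix {c : ℝ} (hc : c ≠ 0) {a : ℝ} (ha : 0 < a) :
    GreenData (DeltaT n M c) (QT n M) (QsT n M) a (Matrix.toEuclideanLin (Gm n M a c))
      (Matrix.toEuclideanLin (Cm n M a c)) where
  g_left x := by
    apply WithLp.ofLp_injective 2
    show Gm n M a c *ᵥ WithLp.ofLp (DeltaT n M c x + a • QsT n M (QT n M x)) = WithLp.ofLp x
    rw [WithLp.ofLp_add, WithLp.ofLp_smul, ofLp_DeltaT, ofLp_QsT, ofLp_QT, ← Km_mulVec, Matrix.mulVec_mulVec,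
      Gm_mul_Km n M hc ha, Matrix.one_mulVec]
  g_right x := by
    apply WithLp.ofLp_injective 2
    rw [WithLp.ofLp_add, WithLp.ofLp_smul, ofLp_DeltaT, ofLp_QsT, ofLp_QT]
    show reM (LapS (fine n M) (c : ℂ)) *ᵥ (Gm n M a c *ᵥ WithLp.ofLp x)
        + a • ((reM (QsOp n M))ᵀ *ᵥ (reM (QsOp n M) *ᵥ (Gm n M a c *ᵥ WithLp.ofLp x))) = WithLp.ofLp x
    rw [← Km_mulVec, Matrix.mulVec_mulVec, Km_mul_Gm n M hc ha, Matrix.one_mulVec]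
  c_left φ := by
    apply WithLp.ofLp_injective 2
    show Cm n M a c *ᵥ (reM (QsOp n M) *ᵥ (Gm n M a c *ᵥ (Gm n M a c *ᵥ ((reM (QsOp n M))ᵀ *ᵥ WithLp.ofLp φ))))
        = WithLp.ofLp φ
    rw [← QGGQm_mulVec, Matrix.mulVec_mulVec, Cm_mul_QGGQm n M hc ha, Matrix.one_mulVec]
  c_right φ := by
    apply WithLp.ofLp_injective 2
    show reM (QsOp n M) *ᵥ (Gm n M a c *ᵥ (Gm n M a c *ᵥ ((reM (QsOp n M))ᵀ *ᵥ (Cm n M a c *ᵥ WithLp.ofLp φ))))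
        = WithLp.ofLp φ
    rw [← QGGQm_mulVec, Matrix.mulVec_mulVec, QGGQm_mul_Cm n M hc ha, Matrix.one_mulVec]

/-! ## §2  `P_G` and the gradient sandwich -/

/-- **`P_G := G′Q′ᵀ(Q′G′²Q′ᵀ)⁻¹Q′G′`** — the CONCRETE (1.44)-form gauge-fixing projection on pv15's carrier (real
matrix; transpose-adjoint convention, parameter `a > 0`; by `B5Projector144.R144_indep` the operator does not depend on
`a`). [model] -/
def PGm (a c : ℝ) : Matrix (Tor (fine n M)) (Tor (fine n M)) ℝ :=
  Gm n M a c * (reM (QsOp n M))ᵀ * Cm n M a c * reM (QsOp n M) * Gm n M a c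

/-- `P_G` acts as the composition. [folklore] -/
theorem PGm_mulVec (a c : ℝ) (u : Tor (fine n M) → ℝ) :
    PGm n M a c *ᵥ u
      = Gm n M a c *ᵥ ((reM (QsOp n M))ᵀ *ᵥ (Cm n M a c *ᵥ (reM (QsOp n M) *ᵥ (Gm n M a c *ᵥ u)))) := by
  rw [PGm, ← Matrix.mulVec_mulVec, ← Matrix.mulVec_mulVec, ← Matrix.mulVec_mulVec, ← Matrix.mulVec_mulVec]

/-- **`Re PcT u = P_G u` FOR EVERY REAL FIELD `u ⊥ 1`** (`c ≠ 0`, `a > 0`): the (1.70) form (pv15) and the concrete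
(1.44) form agree off the constants. [folklore] -/
theorem reM_PcT_mulVec_of_orth {c : ℝ} (hc : c ≠ 0) {a : ℝ} (ha : 0 < a) (u : Tor (fine n M) → ℝ)
    (hu : ∑ x, u x = 0) : reM (PcT n M (c : ℂ)) *ᵥ u = PGm n M a c *ᵥ u := by
  have h := PcT_apply_eq_P144 n M hc (greenData_matrix n M hc ha) (WithLp.toLp 2 u)
    (by rw [inner_oneT, WithLp.ofLp_toLp]; exact hu)
  have h' := congrArg WithLp.ofLp h
  rw [WithLp.ofLp_toLp, WithLp.ofLp_toLp, P144_apply] at h'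
  rw [h', PGm_mulVec]
  rfl

/-- The rows of the gradient matrix sum to zero: `Σ_y ∂_c((x,ν), y) = c·(1 − 1) = 0` (every column of `∂ᴴ`, i.e. every
field `∂*A`, is orthogonal to the constants on the torus). [folklore] -/
theorem sum_reM_GradOp_row (c : ℝ) (j : Tor (fine n M) × Fin d) :
    ∑ y, reM (GradOp (fine n M) (c : ℂ)) j y = 0 := by
  have h1 : ∑ y, reM (GradOp (fine n M) (c : ℂ)) j y
      = (reM (GradOp (fine n M) (c : ℂ)) *ᵥ fun _ => (1 : ℝ)) j := by
    simp only [Matrix.mulVec, dotProduct, mul_one]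
  have h2 : (reM (GradOp (fine n M) (c : ℂ)) *ᵥ fun _ => (1 : ℝ)) = 0 := by
    apply cplx_injective
    rw [(isReal_GradOp (fine n M) (conj_ofReal' c)).cplx_mulVec, cplx_one]
    have : GradOp (fine n M) (c : ℂ) *ᵥ (fun _ : Tor (fine n M) => (1 : ℂ)) = 0 := by
      funext i
      obtain ⟨x, ν⟩ := i
      rw [B5Action121.GradOp_mulVec, B5Action121.sdiff_mulVec, sub_self, mul_zero, Pi.zero_apply]
    rw [this]
    exact ((cplx_eq_zero_iff _).mpr rfl).symm
  rw [h1, h2, Pi.zero_apply]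

/-- `Re PcT · (Re ∂)ᵀ = P_G · (Re ∂)ᵀ`: every column of `(Re ∂)ᵀ` is orthogonal to the constants. [folklore] -/
theorem reM_PcT_mul_GradOp_transpose {c : ℝ} (hc : c ≠ 0) {a : ℝ} (ha : 0 < a) :
    reM (PcT n M (c : ℂ)) * (reM (GradOp (fine n M) (c : ℂ)))ᵀ
      = PGm n M a c * (reM (GradOp (fine n M) (c : ℂ)))ᵀ := by
  ext k j
  have hcol : ∀ X : Matrix (Tor (fine n M)) (Tor (fine n M)) ℝ,
      (X * (reM (GradOp (fine n M) (c : ℂ)))ᵀ) k j = (X *ᵥ fun y => reM (GradOp (fine n M) (c : ℂ)) j y) k := by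
    intro X
    simp only [Matrix.mul_apply, Matrix.transpose_apply, Matrix.mulVec, dotProduct]
  rw [hcol, hcol, reM_PcT_mulVec_of_orth n M hc ha _ (sum_reM_GradOp_row n M c j)]

/-- **BRIDGE-126, PART 1 — THE GAUGE PART OF `Δ_a` IN THE CONCRETE (1.44) FORM.**  For every real lattice parameter
`c ≠ 0` and every `a > 0`:
`Re(∂_c · PcT · ∂_cᴴ) = Re ∂_c · [G′Q′ᵀ(Q′G′²Q′ᵀ)⁻¹Q′G′] · (Re ∂_c)ᵀ`, `G′ = (Re Δ_c + a·Q′ᵀQ′)⁻¹` — pv15's `∂P∂*` of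
[B5] (1.69)–(1.70) (the operator inside `B5DeltaA169.DeltaA`, hence inside NE3's `SliceFlatMassTerm.gaugeDev`) equals the
gradient sandwich of the (1.44)-form projection with CONCRETE matrix inverses.  Part 2 (not here) matches `G′Q′ᵀ`,
`Q′G′²Q′ᵀ`, `(Q′G′²Q′ᵀ)⁻¹`, `Re ∂_n` with b04∕b05's `K_T`, `qggqRe`, `kerRe`, `Dmat` across the carrier bijection
`Tor (fine n N) ≃ Idx (n·N)`, after which `B5DPD126Uniform.matrixP_decay_uniform` is the (3.49) gauge half at `U = 1`.
[folklore] -/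
theorem reM_GradOp_PcT_GradOp {c : ℝ} (hc : c ≠ 0) {a : ℝ} (ha : 0 < a) :
    reM (GradOp (fine n M) (c : ℂ) * PcT n M (c : ℂ) * (GradOp (fine n M) (c : ℂ))ᴴ)
      = reM (GradOp (fine n M) (c : ℂ)) * PGm n M a c * (reM (GradOp (fine n M) (c : ℂ)))ᵀ := by
  have hR := conj_ofReal' c
  have hG := isReal_GradOp (fine n M) hR
  have hP := isReal_PcT n M hR
  rw [(hG.mul hP).reM_mul hG.conjTranspose, hG.reM_mul hP, reM_conjTranspose, Matrix.mul_assoc,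
    reM_PcT_mul_GradOp_transpose n M hc ha, ← Matrix.mul_assoc]

end Summit.QuantumFields.BalabanUV.T4Continuum.SliceFlatGaugeGreen
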